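import Summits.QuantumFields.YangMills.Theorems.FluctuationComparisonRegPrIntLS2BetaRelativeFieldLetter
import Summits.QuantumFields.YangMills.Theorems.FluctuationComparisonRegPrIntLS2BetaSlotDoubleCounting
import Literature.MathematicalPhysics.QuantumFieldTheory.Balaban1983to89.B10StarCount
import HarnessLib

/-!
# S2β · `hFlat` road, brick (ii-b)₅ of UV3-NODE §57.8 (D) — THE ℓ² RELATIVE LETTERS AT ONE LEVEL OF THE AVERAGING TOWER

Cell `ym3-torus` (rung R3 = continuum `SU(2)` Yang–Mills on the three-torus — NOT d = 4, NOT infinite volume, NOT a mass gap, NOT Clay).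
Width seat «width 13» `ym3-torus-px13` (gen 22), FREE px helper on crux `stmt-QuantumFields-20520` (`Theses.UnitScaleTilt.FluctuationComparisonRegPrIntL`),
count-neutral, DEFINITION-FREE, any gauge group `[GaugeGroup G]`, any height `j` of the `Setup` tower in the standing range `j + 1 ≤ m + K`.

WHY (UV3-NODE §57.8 (B) (R2), px8 g21).  The recursion `B_t ≤ √L·B_{t+1} + R_t` needs `R_t² = Σ_b dist1(W_b·U₀,b⁻¹)²` (the ℓ² size of the relative field of
the level-`t` configuration `W` in the comb axial gauge RELATIVE TO the lifted background `U₀`) bounded by ONE-LEVEL plaquette and correction norms with a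
constant polynomial in `L`.  ✓(ii-b)₂ `…RelativeFieldLetter` gave the letters bond by bond over configuration-independent plaquette-slot families with LOCALITY
clauses; ✓(ii-b)₄ `…SlotDoubleCounting` the generic double count.  This file supplies the torus half and assembles:
* §1 `blockOf_transl_emb` — a translate of a centre by `|w_ι| ≤ (L−1)∕2` lies in that centre's block (`Site.blockOf_blockSite`); `blockOf_transl_emb_face` — with
  `0 ≤ w_μ < L` on one axis it lies in that block or the next; `card_bonds_of_block` — `L^d` bonds of a given direction per block.
* §2 `card_filter_sigma_eq_sum`, ★ `card_fiber_le` — a block-local slot map recording the bond's direction hits every plaquette position at most `2·L^d·K`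
  times (`K` = slots per bond).
* §3 `card_slots_interior_le` ∕ `card_slots_face_le` (`K = (d−1)(L−1)∕2`, `K′ = K(L+1)`), `card_faceBonds_le` ∕ `sum_faceBonds_le` (`L^{d−1}` face bonds per coarse
  bond), ★★★ `interior_sq_sum_le`, ★★★ `face_sq_sum_le`, ★★★ `sq_sum_le` — for `W` comb-axial relative to `U₀` from every block centre
  (`∀ x, axialT W (emb (blockOf x)) x = axialT U₀ (emb (blockOf x)) x`, the (T4) clause of the stage-gauge tower):
  `Σ_b dist1(W_b·U₀,b⁻¹)² ≤ C₁(d,L)·(Σ_q dist1 W(∂q)² + Σ_q dist1 U₀(∂q)²) + 2L^{d−1}·Σ_c dist1 (U_W(c)·U₀(c)⁻¹)²`,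
  `C₁ = 2K(2L^dK) + 4K′(2L^dK′)`, `q` over plaquette positions `(site; μ ≠ κ)` (both axis orders), `c` over coarse bonds, `U_X(c) = AveragingRT.axialAvg X c` the
  straight coarse transporters — the coarse field enters ONLY through these spine quotients (= `corr ℰ W c` when the background reproduces the averages).

HONEST SCOPE.  Kinematic∕combinatorial bookkeeping over landed letters; the constants are crude (no injectivity of the slot maps is used); nothing of Bałaban's
analysis ([Balaban1985RegularSpaces] Lemma 1 is the printed sup statement); the lift `U₀`, its curvature (px12 g23 (ii-c)), the KEY LEMMA and the recursion's
solution are elsewhere; `hFlat`, TUBE-REG∘, GAP♯∘, S2β, crux 20520, `YM3TorusSU2` NOT proved; no registered stub is closed; the Yang–Mills mass gap is NOT proved.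
References: T. Bałaban, CMP **99** (1985) 75–102 [Balaban1985RegularSpaces] (Lemma 1 (1.24)–(1.26) pp.79–80, (1.29) p.81); CMP **109** (1987) 249–301 [Balaban1987RG1]
((0.1)–(0.4) pp.251–253); CMP **98** (1985) 17–51 [Balaban1985Averaging] ((19)–(20) p.21).
-/

set_option autoImplicit false

namespace Summit.QuantumFields.YangMills.Theorems.FluctuationComparisonRegPrIntLS2BetaRelativeFieldSquareSum

open Finset
open Literature.MathematicalPhysics.QuantumFieldTheory.Balaban1983to89
open T4Continuum T4ReflectionCone BlockAveraging
open B10Eq47AxialChi (shiftN rowProd rect)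
open B10Eq27TorusAxialLog (transl rel axialT transl_apply transl_add transl_zero)
open B7Prop1Explicit (e e_apply)
open Summit.QuantumFields.YangMills.Theorems.FluctuationComparisonRegPrIntLS2BetaIterAxialGaugeOneLevel (natAbs_rel_emb_le emb_shift_eq_transl)
open Summit.QuantumFields.YangMills.Theorems.FluctuationComparisonRegPrIntLS2BetaRelativeFieldLetter
open Summit.QuantumFields.YangMills.Theorems.FluctuationComparisonRegPrIntLS2BetaSlotDoubleCounting

variable {P : Params} {j : ℕ}

/-! ## §1 Block geometry: a site within `(L−1)∕2` of a centre lies in that centre's block -/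

section Geometry

/-- **A translate of a centre by a small offset lies in the centre's block**: `|w_ι| ≤ (L−1)∕2` for all `ι` ⟹ `blockOf (emb y + w) = y` (standing range).
[cite: Balaban1987RG1, (0.1), (0.3) p.252] -/
theorem blockOf_transl_emb (hj : j + 1 ≤ P.m + P.K) (y : Site P (j + 1)) (w : Fin P.d → ℤ) (hw : ∀ ι, (w ι).natAbs ≤ (P.L - 1) / 2) :
    blockOf (transl (emb y) w) = y := by
  have hL := AveragingRT.two_mul_half_add_one P
  -- the offset from the block's lowest label
  have hr : ∀ ι, (w ι + (((P.L - 1) / 2 : ℕ) : ℤ)).toNat < P.L := fun ι => by have := hw ι; omega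
  have heq : transl (emb y) w = Site.blockSite y (fun ι => ⟨_, hr ι⟩) := by
    funext ι
    rw [transl_apply]
    simp only [emb, Site.blockSite]
    have key : (((y ι).val * P.L + (P.L - 1) / 2 : ℕ) : ℤ) + w ι =
        (((y ι).val * P.L + (w ι + (((P.L - 1) / 2 : ℕ) : ℤ)).toNat : ℕ) : ℤ) := by
      have := hw ι
      generalize (y ι).val * P.L = n
      omega
    have hzmod := congrArg (Int.cast : ℤ → ZMod (P.sitesPerDir j)) key
    rw [Int.cast_add, Int.cast_natCast, Int.cast_natCast] at hzmod
    exact hzmod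
  rw [heq, Site.blockOf_blockSite hj]

/-- The FACE version: `|w_ι| ≤ (L−1)∕2` off the axis `μ` and `0 ≤ w_μ < L` ⟹ `emb y + w` lies in the block of `y` or of `y + e_μ`.
[cite: Balaban1987RG1, (0.1), (0.3) p.252] -/
theorem blockOf_transl_emb_face (hj : j + 1 ≤ P.m + P.K) (y : Site P (j + 1)) (w : Fin P.d → ℤ) (μ : Fin P.d)
    (hw : ∀ ι, ι ≠ μ → (w ι).natAbs ≤ (P.L - 1) / 2) (h0 : 0 ≤ w μ) (hL' : w μ < P.L) :
    blockOf (transl (emb y) w) = y ∨ blockOf (transl (emb y) w) = y.shift μ := by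
  have hL := AveragingRT.two_mul_half_add_one P
  by_cases hsmall : (w μ).natAbs ≤ (P.L - 1) / 2
  · left
    exact blockOf_transl_emb hj y w fun ι => by
      by_cases hι : ι = μ
      · subst hι; exact hsmall
      · exact hw ι hι
  · right
    -- `emb y + w = emb (y + e_μ) + (w − L e_μ)` with a small offset
    have heq : transl (emb y) w = transl (emb (y.shift μ)) (w - (P.L : ℤ) • e μ) := by
      rw [emb_shift_eq_transl, ← transl_add, add_sub_cancel]
    rw [heq]
    refine blockOf_transl_emb hj (y.shift μ) _ fun ι => ?_
    rw [Pi.sub_apply, Pi.smul_apply, e_apply, smul_eq_mul]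
    by_cases hι : ι = μ
    · subst hι; rw [if_pos rfl, mul_one]; omega
    · rw [if_neg hι, mul_zero, sub_zero]; exact hw ι hι

/-- **Bonds of one direction out of one block: exactly `L^d`.** [cite: Balaban1987RG1, (0.3) p.252] -/
theorem card_bonds_of_block (hj : j + 1 ≤ P.m + P.K) (y : Site P (j + 1)) (μ : Fin P.d) :
    #{b : PBond P j | b.dir = μ ∧ blockOf b.src = y} = P.L ^ P.d := by
  rw [← Site.card_block hj y]
  refine card_nbij' (fun b : PBond P j => b.src) (fun x : Site P j => (⟨x, μ⟩ : PBond P j)) (fun b hb => ?_) (fun x hx => ?_)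
    (fun b hb => ?_) (fun x _ => rfl)
  · simp only [mem_coe, mem_filter, mem_univ, true_and, block] at hb ⊢
    exact hb.2
  · simp only [mem_coe, mem_filter, mem_univ, true_and, block] at hx ⊢
    exact hx
  · simp only [mem_coe, mem_filter, mem_univ, true_and] at hb
    obtain ⟨src, dir⟩ := b
    obtain ⟨hd, -⟩ := hb
    simp only at hd
    subst hd
    rfl

end Geometry

/-! ## §2 Fibre multiplicity of a block-local slot map -/

section Fibre

variable {σ : Type*}

/-- The fibre count of a `sigma`-indexed family splits over the first index. [folklore] -/
theorem card_filter_sigma_eq_sum {ι : Type*} (B : Finset ι) (S : ι → Finset σ) (p : (Σ _ : ι, σ) → Prop) [DecidablePred p] :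
    #{x ∈ B.sigma (fun b => S b) | p x} = ∑ b ∈ B, #{s ∈ S b | p ⟨b, s⟩} := by
  rw [card_filter, sum_sigma]
  simp only [card_filter]

/-- ★ **MULTIPLICITY OF A BLOCK-LOCAL SLOT MAP** (standing range): if every slot of the bond `b` sits in the block of `b`'s source or in
the next block along `b`'s direction (the locality of ✓(ii-b)₂'s slot families, read through §1), the slots per bond are at most `K`, and a slot
records `b`'s direction, then every plaquette position is hit by at most `2·L^d·K` (bond, slot) pairs. [cite: Balaban1987RG1, (0.3) p.252] -/
theorem card_fiber_le (hj : j + 1 ≤ P.m + P.K) (B : Finset (PBond P j)) (S : PBond P j → Finset σ)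
    (g : PBond P j → σ → Site P j) (k : PBond P j → σ → Fin P.d)
    (hloc : ∀ b ∈ B, ∀ s ∈ S b, blockOf (g b s) = blockOf b.src ∨ blockOf (g b s) = (blockOf b.src).shift b.dir)
    {K : ℕ} (hK : ∀ b ∈ B, #(S b) ≤ K) (p : Site P j × Fin P.d × Fin P.d) :
    #{x ∈ B.sigma (fun b => S b) | (g x.1 x.2, x.1.dir, k x.1 x.2) = p} ≤ 2 * P.L ^ P.d * K := by
  classical
  obtain ⟨s₀, μ₀, κ₀⟩ := p
  rw [card_filter_sigma_eq_sum]
  -- only bonds of direction `μ₀` whose block is `blockOf s₀` or `blockOf s₀ − e_{μ₀}` contribute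
  set C : Finset (PBond P j) := (univ.filter fun b : PBond P j => b.dir = μ₀ ∧ blockOf b.src = blockOf s₀) ∪
      (univ.filter fun b : PBond P j => b.dir = μ₀ ∧ blockOf b.src = (blockOf s₀).unshift μ₀) with hC
  have hzero : ∀ b ∈ B, b ∉ C → #{s ∈ S b | (g b s, b.dir, k b s) = (s₀, μ₀, κ₀)} = 0 := by
    intro b hb hbC
    rw [card_eq_zero, filter_eq_empty_iff]
    intro s hs heq
    simp only [Prod.mk.injEq] at heq
    obtain ⟨hg, hd, -⟩ := heq
    apply hbC
    rw [hC, mem_union, mem_filter, mem_filter]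
    rcases hloc b hb s hs with h | h
    · exact Or.inl ⟨mem_univ _, hd, by rw [← h, hg]⟩
    · refine Or.inr ⟨mem_univ _, hd, ?_⟩
      rw [hg, hd] at h
      rw [h, Site.unshift_shift]
  have hCcard : #C ≤ P.L ^ P.d + P.L ^ P.d := by
    refine (card_union_le _ _).trans ?_
    rw [card_bonds_of_block hj, card_bonds_of_block hj]
  calc ∑ b ∈ B, #{s ∈ S b | (g b s, b.dir, k b s) = (s₀, μ₀, κ₀)}
      = ∑ b ∈ B with b ∈ C, #{s ∈ S b | (g b s, b.dir, k b s) = (s₀, μ₀, κ₀)} +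
          ∑ b ∈ B with b ∉ C, #{s ∈ S b | (g b s, b.dir, k b s) = (s₀, μ₀, κ₀)} :=
        (sum_filter_add_sum_filter_not B (· ∈ C) _).symm
    _ = ∑ b ∈ B with b ∈ C, #{s ∈ S b | (g b s, b.dir, k b s) = (s₀, μ₀, κ₀)} := by
        rw [sum_eq_zero (s := B.filter fun b => b ∉ C) (fun b hb => hzero b (mem_filter.mp hb).1 (mem_filter.mp hb).2), add_zero]
    _ ≤ ∑ b ∈ B with b ∈ C, K := sum_le_sum fun b hb => (card_filter_le _ _).trans (hK b (mem_filter.mp hb).1)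
    _ = #(B.filter fun b => b ∈ C) * K := by rw [sum_const, smul_eq_mul]
    _ ≤ #C * K := Nat.mul_le_mul_right _ (card_le_card fun b hb => (mem_filter.mp hb).2)
    _ ≤ (P.L ^ P.d + P.L ^ P.d) * K := Nat.mul_le_mul_right _ hCcard
    _ = 2 * P.L ^ P.d * K := by ring

end Fibre

/-! ## §3 The ℓ² relative letters at one level of the averaging tower -/

section SquareSum

variable {G : Type*} [GaugeGroup G]

/-- The slot count of an interior bond: `Σ_{κ ≠ μ} |(x − emb y)_κ| ≤ (d−1)·(L−1)∕2`. [cite: Balaban1987RG1, (0.3) p.252] -/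
theorem card_slots_interior_le (hj : j + 1 ≤ P.m + P.K) (x : Site P j) (μ : Fin P.d) :
    #((univ.erase μ).sigma fun κ => range (rel (emb (blockOf x)) x κ).natAbs) ≤ (P.d - 1) * ((P.L - 1) / 2) := by
  rw [card_sigma]
  calc ∑ κ ∈ univ.erase μ, #(range (rel (emb (blockOf x)) x κ).natAbs)
      ≤ ∑ _κ ∈ univ.erase μ, (P.L - 1) / 2 := sum_le_sum fun κ _ => by
        rw [card_range]; exact natAbs_rel_emb_le hj rfl κ
    _ = (P.d - 1) * ((P.L - 1) / 2) := by rw [sum_const, smul_eq_mul, card_erase_of_mem (mem_univ μ), card_univ, Fintype.card_fin]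

/-- The slot count of a face bond: `(L+1)·Σ_{κ ≠ μ} |(x − emb y)_κ| ≤ (d−1)·((L−1)∕2)·(L+1)`. [cite: Balaban1987RG1, (0.3) p.252] -/
theorem card_slots_face_le (hj : j + 1 ≤ P.m + P.K) (x : Site P j) (μ : Fin P.d) :
    #(((univ.erase μ).sigma fun κ => range (rel (emb (blockOf x)) x κ).natAbs) ×ˢ range (P.L + 1)) ≤
      (P.d - 1) * ((P.L - 1) / 2) * (P.L + 1) := by
  rw [card_product, card_range]
  exact Nat.mul_le_mul_right _ (card_slots_interior_le hj x μ)

/-- ★★★ **THE ℓ² RELATIVE INTERIOR LETTER AT ONE LEVEL** (standing range, any gauge group): for `W` in the comb axial gauge RELATIVE TO `U₀` from every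
block centre, the sum over the INTERIOR bonds (both endpoints in one block) of `dist1(W_b·U₀,b⁻¹)²` is at most
`2·K·(2L^d·K)·(Σ_q dist1 W(∂q)² + Σ_q dist1 U₀(∂q)²)`, `K = (d−1)(L−1)∕2`, the plaquette sums running over all positions `q = (site; μ, κ)`, `μ ≠ κ`
(each geometric plaquette counted in both orders of its axes). ✓(ii-b)₂ pointwise letter + ✓(ii-b)₄ double counting + §2 multiplicity.
[cite: Balaban1985RegularSpaces, Lemma 1 (1.25) p.79, (1.29) p.81] -/
theorem interior_sq_sum_le (hj : j + 1 ≤ P.m + P.K) (W U₀ : GaugeField P j G)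
    (hax : ∀ x : Site P j, axialT W (emb (blockOf x)) x = axialT U₀ (emb (blockOf x)) x) :
    ∑ b ∈ (univ : Finset (PBond P j)).filter (fun b => ¬ ((b.src b.dir).val % P.L + 1 = P.L)), dist1 (W b * (U₀ b)⁻¹) ^ 2 ≤
      2 * ((P.d - 1) * ((P.L - 1) / 2) : ℕ) * (2 * P.L ^ P.d * ((P.d - 1) * ((P.L - 1) / 2)) : ℕ) *
        (∑ q ∈ (univ : Finset (Site P j × Fin P.d × Fin P.d)).filter (fun q => q.2.1 ≠ q.2.2), dist1 (rect W q.1 q.2.1 q.2.2 1 1) ^ 2 +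
          ∑ q ∈ (univ : Finset (Site P j × Fin P.d × Fin P.d)).filter (fun q => q.2.1 ≠ q.2.2), dist1 (rect U₀ q.1 q.2.1 q.2.2 1 1) ^ 2) := by
  classical
  set Bint := (univ : Finset (PBond P j)).filter (fun b => ¬ ((b.src b.dir).val % P.L + 1 = P.L)) with hBint
  have hblock : ∀ b ∈ Bint, blockOf (b.src.shift b.dir) = blockOf b.src := by
    intro b hb
    rw [B10StarCount.blockOf_shift hj, if_neg (mem_filter.mp hb).2]
  -- choose the slot families bond by bond
  have H : ∀ b : PBond P j, ∃ site : Fin P.d → ℕ → Site P j, b ∈ Bint →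
      ((∀ κ, κ ≠ b.dir → ∀ r < (rel (emb (blockOf b.src)) b.src κ).natAbs, ∃ w : Fin P.d → ℤ,
          site κ r = transl (emb (blockOf b.src)) w ∧ ∀ ι, (w ι).natAbs ≤ (rel (emb (blockOf b.src)) b.src ι).natAbs) ∧
        dist1 (W b * (U₀ b)⁻¹) ≤ ∑ κ ∈ univ.erase b.dir, ∑ r ∈ range (rel (emb (blockOf b.src)) b.src κ).natAbs,
          (dist1 (rect W (site κ r) b.dir κ 1 1) + dist1 (rect U₀ (site κ r) b.dir κ 1 1))) := by
    intro b
    by_cases hb : b ∈ Bint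
    · obtain ⟨site, hloc, hbd⟩ := exists_sites_dist1_mul_inv_le_interior (G := G) hj (rfl : blockOf b.src = blockOf b.src) b.dir (hblock b hb)
      exact ⟨site, fun _ => ⟨hloc, hbd W U₀ hax⟩⟩
    · exact ⟨fun _ _ => b.src, fun h => absurd h hb⟩
  choose site hsite using H
  -- the slot data
  set S : PBond P j → Finset (Σ _ : Fin P.d, ℕ) := fun b => (univ.erase b.dir).sigma fun κ => range (rel (emb (blockOf b.src)) b.src κ).natAbs
    with hS
  set f : PBond P j → (Σ _ : Fin P.d, ℕ) → Site P j × Fin P.d × Fin P.d := fun b s => (site b s.1 s.2, b.dir, s.1) with hf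
  set aW : Site P j × Fin P.d × Fin P.d → ℝ := fun q => dist1 (rect W q.1 q.2.1 q.2.2 1 1) with haW
  set a0 : Site P j × Fin P.d × Fin P.d → ℝ := fun q => dist1 (rect U₀ q.1 q.2.1 q.2.2 1 1) with ha0
  have hK : ∀ b ∈ Bint, #(S b) ≤ (P.d - 1) * ((P.L - 1) / 2) := fun b _ => card_slots_interior_le hj b.src b.dir
  have hlocB : ∀ b ∈ Bint, ∀ s ∈ S b, blockOf ((f b s).1) = blockOf b.src ∨ blockOf ((f b s).1) = (blockOf b.src).shift b.dir := by
    intro b hb s hs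
    obtain ⟨hκ, hr⟩ := mem_sigma.mp hs
    obtain ⟨w, hw, hwb⟩ := (hsite b hb).1 s.1 (ne_of_mem_erase hκ) s.2 (mem_range.mp hr)
    left
    show blockOf (site b s.1 s.2) = blockOf b.src
    rw [hw]
    exact blockOf_transl_emb hj _ w fun ι => (hwb ι).trans (natAbs_rel_emb_le hj rfl ι)
  have hM : ∀ p, #{x ∈ Bint.sigma (fun b => S b) | f x.1 x.2 = p} ≤ 2 * P.L ^ P.d * ((P.d - 1) * ((P.L - 1) / 2)) :=
    card_fiber_le hj Bint S (fun b s => site b s.1 s.2) (fun b s => s.1) hlocB hK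
  have hT : ∀ b ∈ Bint, ∀ s ∈ S b, f b s ∈ (univ : Finset (Site P j × Fin P.d × Fin P.d)).filter (fun q => q.2.1 ≠ q.2.2) := by
    intro b _ s hs
    obtain ⟨hκ, -⟩ := mem_sigma.mp hs
    exact mem_filter.mpr ⟨mem_univ _, (ne_of_mem_erase hκ).symm⟩
  have hmain := sum_sq_sum_add_comp_le Bint S f aW a0 hK hM hT
  -- pointwise: `dist1(rel b) ≤ Σ_slots (a_W + a_0)`
  have hpt : ∀ b ∈ Bint, dist1 (W b * (U₀ b)⁻¹) ≤ ∑ s ∈ S b, (aW (f b s) + a0 (f b s)) := by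
    intro b hb
    refine ((hsite b hb).2).trans (le_of_eq ?_)
    rw [hS, sum_sigma']
  calc ∑ b ∈ Bint, dist1 (W b * (U₀ b)⁻¹) ^ 2
      ≤ ∑ b ∈ Bint, (∑ s ∈ S b, (aW (f b s) + a0 (f b s))) ^ 2 :=
        sum_le_sum fun b hb => pow_le_pow_left₀ (GaugeGroup.dist1_nonneg _) (hpt b hb) 2
    _ ≤ _ := hmain

/-- **The face bonds of one coarse bond are `L^{d−1}`** (at most; standing range): bonds `⟨x, μ⟩` with `x` on the `μ`-face of the block of `y`.
[cite: Balaban1987RG1, (0.3) p.252] -/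
theorem card_faceBonds_le (hj : j + 1 ≤ P.m + P.K) (c : PBond P (j + 1)) :
    #{b ∈ (univ : Finset (PBond P j)).filter (fun b => (b.src b.dir).val % P.L + 1 = P.L) |
        (⟨blockOf b.src, b.dir⟩ : PBond P (j + 1)) = c} ≤ P.L ^ (P.d - 1) := by
  rw [← B10StarCount.card_block_filter_top hj c.src c.dir]
  refine card_le_card_of_injOn (fun b : PBond P j => b.src) (fun b hb => ?_) (fun b hb b' hb' h => ?_)
  · simp only [mem_coe, mem_filter, mem_univ, true_and, block] at hb ⊢
    obtain ⟨hface, hc⟩ := hb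
    subst hc
    exact ⟨rfl, hface⟩
  · simp only [mem_coe, mem_filter, mem_univ, true_and] at hb hb'
    obtain ⟨src, dir⟩ := b
    obtain ⟨src', dir'⟩ := b'
    simp only at h hb hb'
    subst h
    have hd : dir = dir' := by
      have h1 := congrArg PBond.dir hb.2
      have h2 := congrArg PBond.dir hb'.2
      simp only at h1 h2
      rw [h1, h2]
    subst hd
    rfl

/-- Summing a coarse-bond quantity over the face bonds costs the factor `L^{d−1}`. [cite: Balaban1987RG1, (0.3) p.252] -/
theorem sum_faceBonds_le (hj : j + 1 ≤ P.m + P.K) (φ : PBond P (j + 1) → ℝ) (hφ : ∀ c, 0 ≤ φ c) :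
    ∑ b ∈ (univ : Finset (PBond P j)).filter (fun b => (b.src b.dir).val % P.L + 1 = P.L), φ ⟨blockOf b.src, b.dir⟩ ≤
      P.L ^ (P.d - 1) * ∑ c : PBond P (j + 1), φ c := by
  rw [← sum_fiberwise' _ (fun b : PBond P j => (⟨blockOf b.src, b.dir⟩ : PBond P (j + 1))) φ, mul_sum]
  refine sum_le_sum fun c _ => ?_
  rw [sum_const, nsmul_eq_mul]
  exact mul_le_mul_of_nonneg_right (by exact_mod_cast card_faceBonds_le hj c) (hφ c)

/-- ★★★ **THE ℓ² RELATIVE FACE LETTER AT ONE LEVEL** (standing range, any gauge group): for `W` in the comb axial gauge relative to `U₀` from every block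
centre, the sum over the FACE bonds of `dist1(W_b·U₀,b⁻¹)²` is at most `4·K′·(2L^d·K′)·(Σ_q dist1 W(∂q)² + Σ_q dist1 U₀(∂q)²) + 2·L^{d−1}·Σ_c dist1 (U_W(c)·U₀(c)⁻¹)²`,
`K′ = (d−1)·((L−1)∕2)·(L+1)`, `c` over the coarse bonds and `U_X(c)` the STRAIGHT coarse transporter `AveragingRT.axialAvg X c` — the coarse field enters only
through the spine quotients (= the corrections `corr ℰ W c` once the background reproduces the averages, ✓(ii-b)₂ `dist1_axialAvg_mul_inv_eq_corr`).
[cite: Balaban1985RegularSpaces, Lemma 1 (1.26) p.79, (1.29) p.81; Balaban1987RG1, (0.4) p.253] -/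
theorem face_sq_sum_le (hj : j + 1 ≤ P.m + P.K) (W U₀ : GaugeField P j G)
    (hax : ∀ x : Site P j, axialT W (emb (blockOf x)) x = axialT U₀ (emb (blockOf x)) x) :
    ∑ b ∈ (univ : Finset (PBond P j)).filter (fun b => (b.src b.dir).val % P.L + 1 = P.L), dist1 (W b * (U₀ b)⁻¹) ^ 2 ≤
      4 * ((P.d - 1) * ((P.L - 1) / 2) * (P.L + 1) : ℕ) * (2 * P.L ^ P.d * ((P.d - 1) * ((P.L - 1) / 2) * (P.L + 1)) : ℕ) *
          (∑ q ∈ (univ : Finset (Site P j × Fin P.d × Fin P.d)).filter (fun q => q.2.1 ≠ q.2.2), dist1 (rect W q.1 q.2.1 q.2.2 1 1) ^ 2 +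
            ∑ q ∈ (univ : Finset (Site P j × Fin P.d × Fin P.d)).filter (fun q => q.2.1 ≠ q.2.2), dist1 (rect U₀ q.1 q.2.1 q.2.2 1 1) ^ 2) +
        2 * P.L ^ (P.d - 1) * ∑ c : PBond P (j + 1), dist1 (AveragingRT.axialAvg W c * (AveragingRT.axialAvg U₀ c)⁻¹) ^ 2 := by
  classical
  set Bf := (univ : Finset (PBond P j)).filter (fun b => (b.src b.dir).val % P.L + 1 = P.L) with hBf
  have hshift : ∀ b ∈ Bf, blockOf (b.src.shift b.dir) = (blockOf b.src).shift b.dir := by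
    intro b hb
    rw [B10StarCount.blockOf_shift hj, if_pos (mem_filter.mp hb).2]
  -- choose the slot families bond by bond
  have H : ∀ b : PBond P j, ∃ site : Fin P.d → ℕ → ℕ → Site P j, b ∈ Bf →
      ((∀ κ, κ ≠ b.dir → ∀ r < (rel (emb (blockOf b.src)) b.src κ).natAbs, ∀ s < P.L + 1, ∃ w : Fin P.d → ℤ,
          site κ r s = transl (emb (blockOf b.src)) w ∧ (∀ ι, ι ≠ b.dir → (w ι).natAbs ≤ (rel (emb (blockOf b.src)) b.src ι).natAbs) ∧
            0 ≤ w b.dir ∧ w b.dir < P.L) ∧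
        dist1 (W b * (U₀ b)⁻¹) ≤
          ∑ κ ∈ univ.erase b.dir, ∑ r ∈ range (rel (emb (blockOf b.src)) b.src κ).natAbs, ∑ s ∈ range (P.L + 1),
              (dist1 (rect W (site κ r s) b.dir κ 1 1) + dist1 (rect U₀ (site κ r s) b.dir κ 1 1)) +
            dist1 (AveragingRT.axialAvg W ⟨blockOf b.src, b.dir⟩ * (AveragingRT.axialAvg U₀ ⟨blockOf b.src, b.dir⟩)⁻¹)) := by
    intro b
    by_cases hb : b ∈ Bf
    · obtain ⟨site, hloc, hbd⟩ :=
        exists_sites_dist1_mul_inv_le_face (G := G) hj (rfl : blockOf b.src = blockOf b.src) (μ := b.dir) (mem_filter.mp hb).2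
      refine ⟨site, fun _ => ⟨hloc, hbd W U₀ (hax b.src) ?_⟩⟩
      have h := hax (b.src.shift b.dir)
      rwa [hshift b hb] at h
    · exact ⟨fun _ _ _ => b.src, fun h => absurd h hb⟩
  choose site hsite using H
  -- the slot data
  set S : PBond P j → Finset ((Σ _ : Fin P.d, ℕ) × ℕ) :=
    fun b => ((univ.erase b.dir).sigma fun κ => range (rel (emb (blockOf b.src)) b.src κ).natAbs) ×ˢ range (P.L + 1) with hS
  set f : PBond P j → (Σ _ : Fin P.d, ℕ) × ℕ → Site P j × Fin P.d × Fin P.d := fun b s => (site b s.1.1 s.1.2 s.2, b.dir, s.1.1) with hf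
  set aW : Site P j × Fin P.d × Fin P.d → ℝ := fun q => dist1 (rect W q.1 q.2.1 q.2.2 1 1) with haW
  set a0 : Site P j × Fin P.d × Fin P.d → ℝ := fun q => dist1 (rect U₀ q.1 q.2.1 q.2.2 1 1) with ha0
  set cb : PBond P j → ℝ := fun b => dist1 (AveragingRT.axialAvg W ⟨blockOf b.src, b.dir⟩ * (AveragingRT.axialAvg U₀ ⟨blockOf b.src, b.dir⟩)⁻¹)
    with hcb
  have hK : ∀ b ∈ Bf, #(S b) ≤ (P.d - 1) * ((P.L - 1) / 2) * (P.L + 1) := fun b _ => card_slots_face_le hj b.src b.dir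
  have hlocB : ∀ b ∈ Bf, ∀ s ∈ S b, blockOf ((f b s).1) = blockOf b.src ∨ blockOf ((f b s).1) = (blockOf b.src).shift b.dir := by
    intro b hb s hs
    obtain ⟨hs1, hs2⟩ := mem_product.mp hs
    obtain ⟨hκ, hr⟩ := mem_sigma.mp hs1
    obtain ⟨w, hw, hwb, hw0, hwL⟩ := (hsite b hb).1 s.1.1 (ne_of_mem_erase hκ) s.1.2 (mem_range.mp hr) s.2 (mem_range.mp hs2)
    show blockOf (site b s.1.1 s.1.2 s.2) = blockOf b.src ∨ blockOf (site b s.1.1 s.1.2 s.2) = (blockOf b.src).shift b.dir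
    rw [hw]
    exact blockOf_transl_emb_face hj _ w b.dir (fun ι hι => (hwb ι hι).trans (natAbs_rel_emb_le hj rfl ι)) hw0 hwL
  have hM : ∀ p, #{x ∈ Bf.sigma (fun b => S b) | f x.1 x.2 = p} ≤ 2 * P.L ^ P.d * ((P.d - 1) * ((P.L - 1) / 2) * (P.L + 1)) :=
    card_fiber_le hj Bf S (fun b s => site b s.1.1 s.1.2 s.2) (fun b s => s.1.1) hlocB hK
  have hT : ∀ b ∈ Bf, ∀ s ∈ S b, f b s ∈ (univ : Finset (Site P j × Fin P.d × Fin P.d)).filter (fun q => q.2.1 ≠ q.2.2) := by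
    intro b _ s hs
    obtain ⟨hκ, -⟩ := mem_sigma.mp (mem_product.mp hs).1
    exact mem_filter.mpr ⟨mem_univ _, (ne_of_mem_erase hκ).symm⟩
  have hmain := sum_sq_sum_add_comp_le Bf S f aW a0 hK hM hT
  -- pointwise: `dist1(rel b) ≤ Σ_slots (a_W + a_0) + c_b`
  have hpt : ∀ b ∈ Bf, dist1 (W b * (U₀ b)⁻¹) ≤ ∑ s ∈ S b, (aW (f b s) + a0 (f b s)) + cb b := by
    intro b hb
    refine ((hsite b hb).2).trans (le_of_eq ?_)
    rw [hS]
    dsimp only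
    rw [sum_product, sum_sigma]
  have hcorr := sum_faceBonds_le hj (fun c => dist1 (AveragingRT.axialAvg W c * (AveragingRT.axialAvg U₀ c)⁻¹) ^ 2) fun c => sq_nonneg _
  calc ∑ b ∈ Bf, dist1 (W b * (U₀ b)⁻¹) ^ 2
      ≤ ∑ b ∈ Bf, (2 * (∑ s ∈ S b, (aW (f b s) + a0 (f b s))) ^ 2 + 2 * cb b ^ 2) := sum_le_sum fun b hb => by
        have h := hpt b hb
        have h0 := GaugeGroup.dist1_nonneg (W b * (U₀ b)⁻¹)
        nlinarith [sq_nonneg (∑ s ∈ S b, (aW (f b s) + a0 (f b s)) - cb b)]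
    _ = 2 * ∑ b ∈ Bf, (∑ s ∈ S b, (aW (f b s) + a0 (f b s))) ^ 2 + 2 * ∑ b ∈ Bf, cb b ^ 2 := by
        rw [sum_add_distrib, mul_sum, mul_sum]
    _ ≤ 2 * ((2 * ((P.d - 1) * ((P.L - 1) / 2) * (P.L + 1) : ℕ) : ℝ) * (2 * P.L ^ P.d * ((P.d - 1) * ((P.L - 1) / 2) * (P.L + 1)) : ℕ) *
          (∑ q ∈ (univ : Finset (Site P j × Fin P.d × Fin P.d)).filter (fun q => q.2.1 ≠ q.2.2), aW q ^ 2 +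
            ∑ q ∈ (univ : Finset (Site P j × Fin P.d × Fin P.d)).filter (fun q => q.2.1 ≠ q.2.2), a0 q ^ 2)) +
        2 * (P.L ^ (P.d - 1) * ∑ c : PBond P (j + 1), dist1 (AveragingRT.axialAvg W c * (AveragingRT.axialAvg U₀ c)⁻¹) ^ 2) := by
        have hmain' : ∑ b ∈ Bf, (∑ s ∈ S b, (aW (f b s) + a0 (f b s))) ^ 2 ≤ _ := hmain
        have hcorr' : ∑ b ∈ Bf, cb b ^ 2 ≤ _ := hcorr
        linarith
    _ = _ := by push_cast; ring

/-- ★★★ **THE ℓ² RELATIVE LETTER AT ONE LEVEL, ALL BONDS** — the kinematic half of UV3-NODE §57.8 (B)'s error term: in the comb axial gauge relative to the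
background, `R² := Σ_b dist1(W_b·U₀,b⁻¹)² ≤ C₁(d, L)·(Σ_q dist1 W(∂q)² + Σ_q dist1 U₀(∂q)²) + 2L^{d−1}·Σ_c dist1 (U_W(c)·U₀(c)⁻¹)²` with
`C₁ = 2K·(2L^dK) + 4K′·(2L^dK′)`, `K = (d−1)(L−1)∕2`, `K′ = K(L+1)` — a polynomial in `L`, as (B) requires. With ✓(ii-b)₃ `sqrt_sum_sq_norm_logVec_le` and
✓(ii-a) this is `B_t ≤ √L·B_{t+1} + R_t` with `R_t` bounded by one-level plaquette and correction norms of `W` and of the lift `U₀`.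
[cite: Balaban1985RegularSpaces, Lemma 1 (1.25)-(1.26) p.79, (1.29) p.81; Balaban1987RG1, (0.3)-(0.4) pp.252-253] -/
theorem sq_sum_le (hj : j + 1 ≤ P.m + P.K) (W U₀ : GaugeField P j G)
    (hax : ∀ x : Site P j, axialT W (emb (blockOf x)) x = axialT U₀ (emb (blockOf x)) x) :
    ∑ b : PBond P j, dist1 (W b * (U₀ b)⁻¹) ^ 2 ≤
      (2 * ((P.d - 1) * ((P.L - 1) / 2) : ℕ) * (2 * P.L ^ P.d * ((P.d - 1) * ((P.L - 1) / 2)) : ℕ) +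
          4 * ((P.d - 1) * ((P.L - 1) / 2) * (P.L + 1) : ℕ) * (2 * P.L ^ P.d * ((P.d - 1) * ((P.L - 1) / 2) * (P.L + 1)) : ℕ)) *
          (∑ q ∈ (univ : Finset (Site P j × Fin P.d × Fin P.d)).filter (fun q => q.2.1 ≠ q.2.2), dist1 (rect W q.1 q.2.1 q.2.2 1 1) ^ 2 +
            ∑ q ∈ (univ : Finset (Site P j × Fin P.d × Fin P.d)).filter (fun q => q.2.1 ≠ q.2.2), dist1 (rect U₀ q.1 q.2.1 q.2.2 1 1) ^ 2) +
        2 * P.L ^ (P.d - 1) * ∑ c : PBond P (j + 1), dist1 (AveragingRT.axialAvg W c * (AveragingRT.axialAvg U₀ c)⁻¹) ^ 2 := by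
  have hi := interior_sq_sum_le hj W U₀ hax
  have hf := face_sq_sum_le hj W U₀ hax
  rw [← sum_filter_add_sum_filter_not univ (fun b : PBond P j => (b.src b.dir).val % P.L + 1 = P.L)]
  linarith

end SquareSum

end Summit.QuantumFields.YangMills.Theorems.FluctuationComparisonRegPrIntLS2BetaRelativeFieldSquareSum
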